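import Literature.NumberTheory.LFunctions.Zhang2022.DetectorShiftClosedForm

/-!
# The doubling identity (K2 / D1), part A: half-angle units, recipe atoms, free-end form, closed forms

Sub-cell E of the `landau-siegel` programme, row S-E-p5-12 (E-102 head 2, KERNEL PLAN OF RECORD = DOUBLING,
ls-barrier-plan g1 2026-08-27T01:45:23Z / 01:54:52Z; statement shapes = ls-barrier-num g2's ShadowKernelSketch
1268210b689bb6c5; proof skeleton = ls-barrier-num g2 2026-08-27T01:53:01Z; symbolic confirmation kit j265090/j265247,
float check `k2_float_check.py`). ORIENTATION (planner ruling (3)): PERIODIC — the Euler–Lagrange extremal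
`F = γ₀ + Σ_m γ_(m+1) e^(−iπ b_m t)` of the bulk form on `[0,1]`, CLAMPED at `t = 0`, with data `(F, F′)(1) = (x₁, x₂)`.

This file (part A) lands: the half-angle units `u_m = e^(iπb_m/2)` (`conj u_m = u_m⁻¹`, `e^(−iπb_m) = u_m⁻²`), the
channel weights `W_j` in them, the recipe atoms `A₀, A_b, A_N` and Zhang's free-end form `freeEndForm` being IMPORTED from the tree
(`DetectorShiftClosedForm`, p486415), the atoms written out in the `u_m`, and the CLOSED FORMS of `Re A₀`, `Im A₀`, `Im A_b`, `A_N`, `conj A_N` as single fractions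
over `D = 2u₀u₁u₂(b₀−b₁)(b₀−b₂)(b₁−b₂)` (kit j265619; `2c₀·D⁻¹`-numerator = the 12-term polynomial `Q` of part B, so the
clamped solve is possible iff `c₀ ≠ 0`). Part B (`DetectorDoublingIdentity`) lands the exponential extremals, the
explicit clamped solve and the jet map; the integration-by-parts identity and the assembled
`c₀·T_b^([0,1])(F⋆_x) = freeEndForm b x₁ x₂` follow by the append protocol. Nothing here asserts anything about
`L`-functions. -/

noncomputable section

open Complex Real ComplexConjugate

namespace Literature.NumberTheory.LFunctions.Zhang2022

namespace Det

/-! ### Half-angle units and the channel weights in them -/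

/-- The half-angle unit `u_m = e^(iπ b_m/2)`. [cite: Zhang2022LandauSiegel, proof of Prop 7.1, (7.19)–(7.20)] -/
def halfUnit (b : Fin 3 → ℝ) (m : Fin 3) : ℂ := cexp (I * π * (b m : ℂ) / 2)

/-- `u_m ≠ 0`. [cite: Zhang2022LandauSiegel, proof of Prop 7.1, (7.19)] -/
theorem halfUnit_ne_zero (b : Fin 3 → ℝ) (m : Fin 3) : halfUnit b m ≠ 0 := Complex.exp_ne_zero _

/-- `conj u_m = u_m⁻¹` (`b_m` real). [cite: Zhang2022LandauSiegel, proof of Prop 7.1, (7.19)] -/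
theorem conj_halfUnit (b : Fin 3 → ℝ) (m : Fin 3) : conj (halfUnit b m) = (halfUnit b m)⁻¹ := by
  unfold halfUnit
  rw [← Complex.exp_conj, ← Complex.exp_neg]
  congr 1
  simp only [map_div₀, map_mul, Complex.conj_I, Complex.conj_ofReal, map_ofNat]
  ring

/-- `e^(−iπ b_m) = u_m⁻²`. [cite: Zhang2022LandauSiegel, proof of Prop 7.1, (7.19)] -/
theorem cexp_neg_eq_halfUnit (b : Fin 3 → ℝ) (m : Fin 3) :
    cexp (-(I * π * (b m : ℂ))) = ((halfUnit b m) ^ 2)⁻¹ := by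
  unfold halfUnit
  rw [sq, ← Complex.exp_add, ← Complex.exp_neg]
  congr 1
  ring

/-- `W₀ = b₀·(u₁u₂/u₀)/((b₁−b₀)(b₂−b₀))`. [cite: Zhang2022LandauSiegel, proof of Prop 7.1, (7.19)–(7.21)] -/
theorem shiftW_zero_halfUnit (b : Fin 3 → ℝ) :
    shiftW b 0 = (b 0 : ℂ) * (halfUnit b 1 * halfUnit b 2 / halfUnit b 0) / (((b 1 - b 0) * (b 2 - b 0) : ℝ) : ℂ) := by
  unfold shiftW shiftS shiftVdm halfUnit
  simp only [Matrix.cons_val_zero]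
  rw [div_eq_mul_inv (cexp _ * cexp _), ← Complex.exp_add, ← Complex.exp_neg, ← Complex.exp_add]
  congr 2
  push_cast
  ring

/-- `W₁ = b₁·(u₂u₀/u₁)/((b₂−b₁)(b₀−b₁))`. [cite: Zhang2022LandauSiegel, proof of Prop 7.1, (7.19)–(7.21)] -/
theorem shiftW_one_halfUnit (b : Fin 3 → ℝ) :
    shiftW b 1 = (b 1 : ℂ) * (halfUnit b 2 * halfUnit b 0 / halfUnit b 1) / (((b 2 - b 1) * (b 0 - b 1) : ℝ) : ℂ) := by
  unfold shiftW shiftS shiftVdm halfUnit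
  simp only [Matrix.cons_val_one]
  rw [div_eq_mul_inv (cexp _ * cexp _), ← Complex.exp_add, ← Complex.exp_neg, ← Complex.exp_add]
  congr 2
  push_cast
  ring

/-- `W₂ = b₂·(u₀u₁/u₂)/((b₀−b₂)(b₁−b₂))`. [cite: Zhang2022LandauSiegel, proof of Prop 7.1, (7.19)–(7.21)] -/
theorem shiftW_two_halfUnit (b : Fin 3 → ℝ) :
    shiftW b 2 = (b 2 : ℂ) * (halfUnit b 0 * halfUnit b 1 / halfUnit b 2) / (((b 0 - b 2) * (b 1 - b 2) : ℝ) : ℂ) := by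
  unfold shiftW shiftS shiftVdm halfUnit
  simp only [Matrix.cons_val_two, Matrix.tail_cons, Matrix.head_cons]
  rw [div_eq_mul_inv (cexp _ * cexp _), ← Complex.exp_add, ← Complex.exp_neg, ← Complex.exp_add]
  congr 2
  push_cast
  ring

/-! The recipe atoms `Det.atomA0/atomAb/atomAN` and the free-end form `Det.freeEndForm` are the tree's
(`DetectorShiftClosedForm`, ls-barrier-p2 g3, p486415 — ShadowKernelSketch shapes verbatim); imported, not restated. -/

/-! ### The atoms in half-angle units -/

section AtomForms

variable (b : Fin 3 → ℝ)


/-- `A₀` in half-angle units. [cite: Zhang2022LandauSiegel, §7 Prop. 7.1 p.44, (7.19)–(7.21)] -/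
theorem atomA0_halfUnit : atomA0 b =
    (b 0 : ℂ) * (halfUnit b 1 * halfUnit b 2 / halfUnit b 0) / (((b 1 - b 0) * (b 2 - b 0) : ℝ) : ℂ) +
    (b 1 : ℂ) * (halfUnit b 2 * halfUnit b 0 / halfUnit b 1) / (((b 2 - b 1) * (b 0 - b 1) : ℝ) : ℂ) +
    (b 2 : ℂ) * (halfUnit b 0 * halfUnit b 1 / halfUnit b 2) / (((b 0 - b 2) * (b 1 - b 2) : ℝ) : ℂ) := by
  simp only [atomA0, Fin.sum_univ_three, shiftW_zero_halfUnit, shiftW_one_halfUnit, shiftW_two_halfUnit]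

/-- `A_b` in half-angle units. [cite: Zhang2022LandauSiegel, §7 Prop. 7.1 p.44, (7.19)–(7.21)] -/
theorem atomAb_halfUnit : atomAb b =
    (b 0 : ℂ) * (halfUnit b 1 * halfUnit b 2 / halfUnit b 0) / (((b 1 - b 0) * (b 2 - b 0) : ℝ) : ℂ) * (b 0 : ℂ) +
    (b 1 : ℂ) * (halfUnit b 2 * halfUnit b 0 / halfUnit b 1) / (((b 2 - b 1) * (b 0 - b 1) : ℝ) : ℂ) * (b 1 : ℂ) +
    (b 2 : ℂ) * (halfUnit b 0 * halfUnit b 1 / halfUnit b 2) / (((b 0 - b 2) * (b 1 - b 2) : ℝ) : ℂ) * (b 2 : ℂ) := by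
  simp only [atomAb, Fin.sum_univ_three, shiftW_zero_halfUnit, shiftW_one_halfUnit, shiftW_two_halfUnit]

/-- `A_N` in half-angle units. [cite: Zhang2022LandauSiegel, §8 (8.13)–(8.18)] -/
theorem atomAN_halfUnit : atomAN b =
    (b 0 : ℂ) * (halfUnit b 1 * halfUnit b 2 / halfUnit b 0) / (((b 1 - b 0) * (b 2 - b 0) : ℝ) : ℂ) * ((b 1 * b 2 : ℝ) : ℂ) +
    (b 1 : ℂ) * (halfUnit b 2 * halfUnit b 0 / halfUnit b 1) / (((b 2 - b 1) * (b 0 - b 1) : ℝ) : ℂ) * ((b 2 * b 0 : ℝ) : ℂ) +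
    (b 2 : ℂ) * (halfUnit b 0 * halfUnit b 1 / halfUnit b 2) / (((b 0 - b 2) * (b 1 - b 2) : ℝ) : ℂ) * ((b 0 * b 1 : ℝ) : ℂ) := by
  simp only [atomAN, shiftN, Fin.sum_univ_three, shiftW_zero_halfUnit, shiftW_one_halfUnit, shiftW_two_halfUnit,
    Matrix.cons_val_zero, Matrix.cons_val_one, Matrix.cons_val_two, Matrix.tail_cons, Matrix.head_cons]

/-- `conj A₀` in half-angle units. [cite: Zhang2022LandauSiegel, §7 Prop. 7.1 p.44, (7.19)–(7.21)] -/
theorem conj_atomA0_halfUnit : conj (atomA0 b) =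
    (b 0 : ℂ) * ((halfUnit b 1)⁻¹ * (halfUnit b 2)⁻¹ / (halfUnit b 0)⁻¹) / (((b 1 - b 0) * (b 2 - b 0) : ℝ) : ℂ) +
    (b 1 : ℂ) * ((halfUnit b 2)⁻¹ * (halfUnit b 0)⁻¹ / (halfUnit b 1)⁻¹) / (((b 2 - b 1) * (b 0 - b 1) : ℝ) : ℂ) +
    (b 2 : ℂ) * ((halfUnit b 0)⁻¹ * (halfUnit b 1)⁻¹ / (halfUnit b 2)⁻¹) / (((b 0 - b 2) * (b 1 - b 2) : ℝ) : ℂ) := by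
  rw [atomA0_halfUnit]
  simp only [map_add, map_mul, map_div₀, Complex.conj_ofReal, conj_halfUnit]

/-- `conj A_b` in half-angle units. [cite: Zhang2022LandauSiegel, §7 Prop. 7.1 p.44, (7.19)–(7.21)] -/
theorem conj_atomAb_halfUnit : conj (atomAb b) =
    (b 0 : ℂ) * ((halfUnit b 1)⁻¹ * (halfUnit b 2)⁻¹ / (halfUnit b 0)⁻¹) / (((b 1 - b 0) * (b 2 - b 0) : ℝ) : ℂ) * (b 0 : ℂ) +
    (b 1 : ℂ) * ((halfUnit b 2)⁻¹ * (halfUnit b 0)⁻¹ / (halfUnit b 1)⁻¹) / (((b 2 - b 1) * (b 0 - b 1) : ℝ) : ℂ) * (b 1 : ℂ) +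
    (b 2 : ℂ) * ((halfUnit b 0)⁻¹ * (halfUnit b 1)⁻¹ / (halfUnit b 2)⁻¹) / (((b 0 - b 2) * (b 1 - b 2) : ℝ) : ℂ) * (b 2 : ℂ) := by
  rw [atomAb_halfUnit]
  simp only [map_add, map_mul, map_div₀, Complex.conj_ofReal, conj_halfUnit]

/-- `conj A_N` in half-angle units. [cite: Zhang2022LandauSiegel, §8 (8.13)–(8.18)] -/
theorem conj_atomAN_halfUnit : conj (atomAN b) =
    (b 0 : ℂ) * ((halfUnit b 1)⁻¹ * (halfUnit b 2)⁻¹ / (halfUnit b 0)⁻¹) / (((b 1 - b 0) * (b 2 - b 0) : ℝ) : ℂ) *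
        ((b 1 * b 2 : ℝ) : ℂ) +
    (b 1 : ℂ) * ((halfUnit b 2)⁻¹ * (halfUnit b 0)⁻¹ / (halfUnit b 1)⁻¹) / (((b 2 - b 1) * (b 0 - b 1) : ℝ) : ℂ) *
        ((b 2 * b 0 : ℝ) : ℂ) +
    (b 2 : ℂ) * ((halfUnit b 0)⁻¹ * (halfUnit b 1)⁻¹ / (halfUnit b 2)⁻¹) / (((b 0 - b 2) * (b 1 - b 2) : ℝ) : ℂ) *
        ((b 0 * b 1 : ℝ) : ℂ) := by
  rw [atomAN_halfUnit]
  simp only [map_add, map_mul, map_div₀, Complex.conj_ofReal, conj_halfUnit]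

end AtomForms

/-! ### Closed forms over the common denominator -/

/-- The common denominator `D = 2u₀u₁u₂(b₀−b₁)(b₀−b₂)(b₁−b₂)` of the atoms in half-angle units.
[cite: Zhang2022LandauSiegel, §7 Prop. 7.1 p.44, (7.19)–(7.21)] -/
def dblD (b : Fin 3 → ℝ) : ℂ :=
  2 * halfUnit b 0 * halfUnit b 1 * halfUnit b 2 * (((b 0 - b 1) * (b 0 - b 2) * (b 1 - b 2) : ℝ) : ℂ)

section Atoms

variable (b : Fin 3 → ℝ)

/-- `D ≠ 0` for pairwise distinct `b`. [cite: Zhang2022LandauSiegel, §7 Prop. 7.1 p.44] -/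
theorem dblD_ne_zero (h01 : b 0 ≠ b 1) (h02 : b 0 ≠ b 2) (h12 : b 1 ≠ b 2) : dblD b ≠ 0 := by
  have h0 := halfUnit_ne_zero b 0; have h1 := halfUnit_ne_zero b 1; have h2 := halfUnit_ne_zero b 2
  have : ((b 0 - b 1) * (b 0 - b 2) * (b 1 - b 2) : ℝ) ≠ 0 :=
    mul_ne_zero (mul_ne_zero (sub_ne_zero.2 h01) (sub_ne_zero.2 h02)) (sub_ne_zero.2 h12)
  unfold dblD
  exact mul_ne_zero (mul_ne_zero (mul_ne_zero (mul_ne_zero two_ne_zero h0) h1) h2) (by exact_mod_cast this)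

/-- `2c₀ = 2Re A₀` as ONE fraction over `D`. [cite: Zhang2022LandauSiegel, §7 Prop. 7.1 p.44, (7.19)–(7.21)] -/
theorem re_atomA0_closed (h01 : b 0 ≠ b 1) (h02 : b 0 ≠ b 2) (h12 : b 1 ≠ b 2) :
    ((atomA0 b).re : ℂ) = (-2 * (b 0 : ℂ) * (b 1 : ℂ) * halfUnit b 0^2 * halfUnit b 2^2 + 2 * (b 0 : ℂ) * (b 1 : ℂ) * halfUnit b 0^2 + 2 * (b 0 : ℂ) * (b 1 : ℂ) * halfUnit b 1^2 * halfUnit b 2^2 - 2 * (b 0 : ℂ) * (b 1 : ℂ) * halfUnit b 1^2 + 2 * (b 0 : ℂ) * (b 2 : ℂ) * halfUnit b 0^2 * halfUnit b 1^2 - 2 * (b 0 : ℂ) * (b 2 : ℂ) * halfUnit b 0^2 - 2 * (b 0 : ℂ) * (b 2 : ℂ) * halfUnit b 1^2 * halfUnit b 2^2 + 2 * (b 0 : ℂ) * (b 2 : ℂ) * halfUnit b 2^2 - 2 * (b 1 : ℂ) * (b 2 : ℂ) * halfUnit b 0^2 * halfUnit b 1^2 + 2 * (b 1 : ℂ) *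 (b 2 : ℂ) * halfUnit b 0^2 * halfUnit b 2^2 + 2 * (b 1 : ℂ) * (b 2 : ℂ) * halfUnit b 1^2 - 2 * (b 1 : ℂ) * (b 2 : ℂ) * halfUnit b 2^2) / dblD b / 2 := by
  have hD := dblD_ne_zero b h01 h02 h12
  have h0 := halfUnit_ne_zero b 0; have h1 := halfUnit_ne_zero b 1; have h2 := halfUnit_ne_zero b 2
  have h01' : ((b 0 : ℝ) : ℂ) - (b 1 : ℂ) ≠ 0 := by rw [sub_ne_zero]; exact_mod_cast h01
  have h02' : ((b 0 : ℝ) : ℂ) - (b 2 : ℂ) ≠ 0 := by rw [sub_ne_zero]; exact_mod_cast h02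
  have h12' : ((b 1 : ℝ) : ℂ) - (b 2 : ℂ) ≠ 0 := by rw [sub_ne_zero]; exact_mod_cast h12
  have h10' : ((b 1 : ℝ) : ℂ) - (b 0 : ℂ) ≠ 0 := by rw [sub_ne_zero]; exact_mod_cast (Ne.symm h01)
  have h20' : ((b 2 : ℝ) : ℂ) - (b 0 : ℂ) ≠ 0 := by rw [sub_ne_zero]; exact_mod_cast (Ne.symm h02)
  have h21' : ((b 2 : ℝ) : ℂ) - (b 1 : ℂ) ≠ 0 := by rw [sub_ne_zero]; exact_mod_cast (Ne.symm h12)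
  rw [Complex.re_eq_add_conj, conj_atomA0_halfUnit, atomA0_halfUnit]
  unfold dblD at hD ⊢
  push_cast at hD ⊢
  field_simp
  ring

/-- `Im A₀` as ONE fraction over `D`. [cite: Zhang2022LandauSiegel, §7 Prop. 7.1 p.44, (7.19)–(7.21)] -/
theorem im_atomA0_closed (h01 : b 0 ≠ b 1) (h02 : b 0 ≠ b 2) (h12 : b 1 ≠ b 2) :
    ((atomA0 b).im : ℂ) = (-2 * (b 0 : ℂ) * (b 1 : ℂ) * halfUnit b 0^2 * halfUnit b 2^2 - 2 * (b 0 : ℂ) * (b 1 : ℂ) * halfUnit b 0^2 + 2 * (b 0 : ℂ) * (b 1 : ℂ) * halfUnit b 1^2 * halfUnit b 2^2 + 2 * (b 0 : ℂ) * (b 1 : ℂ) * halfUnit b 1^2 + 2 * (b 0 : ℂ) * (b 2 : ℂ) * halfUnit b 0^2 * halfUnit b 1^2 + 2 * (b 0 : ℂ) * (b 2 : ℂ) * halfUnit b 0^2 - 2 * (b 0 : ℂ) * (b 2 : ℂ) * halfUnit b 1^2 * halfUnit b 2^2 - 2 * (b 0 : ℂ) * (b 2 : ℂ) * halfUnit b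 2^2 - 2 * (b 1 : ℂ) * (b 2 : ℂ) * halfUnit b 0^2 * halfUnit b 1^2 + 2 * (b 1 : ℂ) * (b 2 : ℂ) * halfUnit b 0^2 * halfUnit b 2^2 - 2 * (b 1 : ℂ) * (b 2 : ℂ) * halfUnit b 1^2 + 2 * (b 1 : ℂ) * (b 2 : ℂ) * halfUnit b 2^2) / dblD b / (2 * I) := by
  have hD := dblD_ne_zero b h01 h02 h12
  have h0 := halfUnit_ne_zero b 0; have h1 := halfUnit_ne_zero b 1; have h2 := halfUnit_ne_zero b 2
  have h01' : ((b 0 : ℝ) : ℂ) - (b 1 : ℂ) ≠ 0 := by rw [sub_ne_zero]; exact_mod_cast h01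
  have h02' : ((b 0 : ℝ) : ℂ) - (b 2 : ℂ) ≠ 0 := by rw [sub_ne_zero]; exact_mod_cast h02
  have h12' : ((b 1 : ℝ) : ℂ) - (b 2 : ℂ) ≠ 0 := by rw [sub_ne_zero]; exact_mod_cast h12
  have h10' : ((b 1 : ℝ) : ℂ) - (b 0 : ℂ) ≠ 0 := by rw [sub_ne_zero]; exact_mod_cast (Ne.symm h01)
  have h20' : ((b 2 : ℝ) : ℂ) - (b 0 : ℂ) ≠ 0 := by rw [sub_ne_zero]; exact_mod_cast (Ne.symm h02)
  have h21' : ((b 2 : ℝ) : ℂ) - (b 1 : ℂ) ≠ 0 := by rw [sub_ne_zero]; exact_mod_cast (Ne.symm h12)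
  rw [Complex.im_eq_sub_conj, conj_atomA0_halfUnit, atomA0_halfUnit]
  unfold dblD at hD ⊢
  push_cast at hD ⊢
  field_simp
  ring

/-- `Im A_b` as ONE fraction over `D`. [cite: Zhang2022LandauSiegel, §7 Prop. 7.1 p.44, (7.19)–(7.21)] -/
theorem im_atomAb_closed (h01 : b 0 ≠ b 1) (h02 : b 0 ≠ b 2) (h12 : b 1 ≠ b 2) :
    ((atomAb b).im : ℂ) = (-2 * (b 0 : ℂ)^2 * (b 1 : ℂ) * halfUnit b 0^2 + 2 * (b 0 : ℂ)^2 * (b 1 : ℂ) * halfUnit b 1^2 * halfUnit b 2^2 + 2 * (b 0 : ℂ)^2 * (b 2 : ℂ) * halfUnit b 0^2 - 2 * (b 0 : ℂ)^2 * (b 2 : ℂ) * halfUnit b 1^2 * halfUnit b 2^2 - 2 * (b 0 : ℂ) * (b 1 : ℂ)^2 * halfUnit b 0^2 * halfUnit b 2^2 + 2 * (b 0 : ℂ) * (b 1 : ℂ)^2 * halfUnit b 1^2 + 2 * (b 0 : ℂ) * (b 2 : ℂ)^2 * halfUnit b 0^2 * halfUnit b 1^2 - 2 * (b 0 : ℂ)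 * (b 2 : ℂ)^2 * halfUnit b 2^2 + 2 * (b 1 : ℂ)^2 * (b 2 : ℂ) * halfUnit b 0^2 * halfUnit b 2^2 - 2 * (b 1 : ℂ)^2 * (b 2 : ℂ) * halfUnit b 1^2 - 2 * (b 1 : ℂ) * (b 2 : ℂ)^2 * halfUnit b 0^2 * halfUnit b 1^2 + 2 * (b 1 : ℂ) * (b 2 : ℂ)^2 * halfUnit b 2^2) / dblD b / (2 * I) := by
  have hD := dblD_ne_zero b h01 h02 h12
  have h0 := halfUnit_ne_zero b 0; have h1 := halfUnit_ne_zero b 1; have h2 := halfUnit_ne_zero b 2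
  have h01' : ((b 0 : ℝ) : ℂ) - (b 1 : ℂ) ≠ 0 := by rw [sub_ne_zero]; exact_mod_cast h01
  have h02' : ((b 0 : ℝ) : ℂ) - (b 2 : ℂ) ≠ 0 := by rw [sub_ne_zero]; exact_mod_cast h02
  have h12' : ((b 1 : ℝ) : ℂ) - (b 2 : ℂ) ≠ 0 := by rw [sub_ne_zero]; exact_mod_cast h12
  have h10' : ((b 1 : ℝ) : ℂ) - (b 0 : ℂ) ≠ 0 := by rw [sub_ne_zero]; exact_mod_cast (Ne.symm h01)
  have h20' : ((b 2 : ℝ) : ℂ) - (b 0 : ℂ) ≠ 0 := by rw [sub_ne_zero]; exact_mod_cast (Ne.symm h02)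
  have h21' : ((b 2 : ℝ) : ℂ) - (b 1 : ℂ) ≠ 0 := by rw [sub_ne_zero]; exact_mod_cast (Ne.symm h12)
  rw [Complex.im_eq_sub_conj, conj_atomAb_halfUnit, atomAb_halfUnit]
  unfold dblD at hD ⊢
  push_cast at hD ⊢
  field_simp
  ring

/-- `A_N` as ONE fraction over `D`. [cite: Zhang2022LandauSiegel, §8 (8.13)–(8.18)] -/
theorem atomAN_closed (h01 : b 0 ≠ b 1) (h02 : b 0 ≠ b 2) (h12 : b 1 ≠ b 2) :
    atomAN b = (2 * (b 0 : ℂ)^2 * (b 1 : ℂ) * (b 2 : ℂ) * halfUnit b 0^2 * halfUnit b 1^2 - 2 * (b 0 : ℂ)^2 * (b 1 : ℂ) * (b 2 : ℂ) * halfUnit b 0^2 * halfUnit b 2^2 - 2 * (b 0 : ℂ) * (b 1 : ℂ)^2 * (b 2 : ℂ) * halfUnit b 0^2 * halfUnit b 1^2 + 2 * (b 0 : ℂ) * (b 1 : ℂ)^2 * (b 2 : ℂ) * halfUnit b 1^2 * halfUnit b 2^2 + 2 * (b 0 : ℂ) * (b 1 : ℂ) * (b 2 : ℂ)^2 * halfUnit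 b 0^2 * halfUnit b 2^2 - 2 * (b 0 : ℂ) * (b 1 : ℂ) * (b 2 : ℂ)^2 * halfUnit b 1^2 * halfUnit b 2^2) / dblD b := by
  have hD := dblD_ne_zero b h01 h02 h12
  have h0 := halfUnit_ne_zero b 0; have h1 := halfUnit_ne_zero b 1; have h2 := halfUnit_ne_zero b 2
  have h01' : ((b 0 : ℝ) : ℂ) - (b 1 : ℂ) ≠ 0 := by rw [sub_ne_zero]; exact_mod_cast h01
  have h02' : ((b 0 : ℝ) : ℂ) - (b 2 : ℂ) ≠ 0 := by rw [sub_ne_zero]; exact_mod_cast h02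
  have h12' : ((b 1 : ℝ) : ℂ) - (b 2 : ℂ) ≠ 0 := by rw [sub_ne_zero]; exact_mod_cast h12
  have h10' : ((b 1 : ℝ) : ℂ) - (b 0 : ℂ) ≠ 0 := by rw [sub_ne_zero]; exact_mod_cast (Ne.symm h01)
  have h20' : ((b 2 : ℝ) : ℂ) - (b 0 : ℂ) ≠ 0 := by rw [sub_ne_zero]; exact_mod_cast (Ne.symm h02)
  have h21' : ((b 2 : ℝ) : ℂ) - (b 1 : ℂ) ≠ 0 := by rw [sub_ne_zero]; exact_mod_cast (Ne.symm h12)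
  rw [atomAN_halfUnit]
  unfold dblD at hD ⊢
  push_cast at hD ⊢
  field_simp
  ring

/-- `conj A_N` as ONE fraction over `D`. [cite: Zhang2022LandauSiegel, §8 (8.13)–(8.18)] -/
theorem conj_atomAN_closed (h01 : b 0 ≠ b 1) (h02 : b 0 ≠ b 2) (h12 : b 1 ≠ b 2) :
    conj (atomAN b) = (-2 * (b 0 : ℂ)^2 * (b 1 : ℂ) * (b 2 : ℂ) * halfUnit b 1^2 + 2 * (b 0 : ℂ)^2 * (b 1 : ℂ) * (b 2 : ℂ) * halfUnit b 2^2 + 2 * (b 0 : ℂ) * (b 1 : ℂ)^2 * (b 2 : ℂ) * halfUnit b 0^2 - 2 * (b 0 : ℂ) * (b 1 : ℂ)^2 * (b 2 : ℂ) * halfUnit b 2^2 - 2 * (b 0 : ℂ) * (b 1 : ℂ) * (b 2 : ℂ)^2 * halfUnit b 0^2 + 2 * (b 0 : ℂ) * (b 1 : ℂ) * (b 2 : ℂ)^2 * halfUnit b 1^2) / dblD b := by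
  have hD := dblD_ne_zero b h01 h02 h12
  have h0 := halfUnit_ne_zero b 0; have h1 := halfUnit_ne_zero b 1; have h2 := halfUnit_ne_zero b 2
  have h01' : ((b 0 : ℝ) : ℂ) - (b 1 : ℂ) ≠ 0 := by rw [sub_ne_zero]; exact_mod_cast h01
  have h02' : ((b 0 : ℝ) : ℂ) - (b 2 : ℂ) ≠ 0 := by rw [sub_ne_zero]; exact_mod_cast h02
  have h12' : ((b 1 : ℝ) : ℂ) - (b 2 : ℂ) ≠ 0 := by rw [sub_ne_zero]; exact_mod_cast h12
  have h10' : ((b 1 : ℝ) : ℂ) - (b 0 : ℂ) ≠ 0 := by rw [sub_ne_zero]; exact_mod_cast (Ne.symm h01)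
  have h20' : ((b 2 : ℝ) : ℂ) - (b 0 : ℂ) ≠ 0 := by rw [sub_ne_zero]; exact_mod_cast (Ne.symm h02)
  have h21' : ((b 2 : ℝ) : ℂ) - (b 1 : ℂ) ≠ 0 := by rw [sub_ne_zero]; exact_mod_cast (Ne.symm h12)
  rw [conj_atomAN_halfUnit]
  unfold dblD at hD ⊢
  push_cast at hD ⊢
  field_simp
  ring

end Atoms

end Det

end Literature.NumberTheory.LFunctions.Zhang2022
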